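import Mathlib.RingTheory.RegularLocalRing.Defs
import Mathlib.RingTheory.Ideal.KrullsHeightTheorem
import Literature.AlgebraicGeometry.Resolution.LogChartFaceSplitting
import HarnessLib

/-!
# Units and monomials in the refined toric charts — preliminaries for Kato (10.3)/(10.4)

`Literature/AlgebraicGeometry/Resolution/LogRefinedChartUnits.lean`. Elementary algebra used in
the identification of the affine charts `A[χ(Q)]` of the toric modification of a log regular
scheme (K. Kato, *Toric singularities*, Amer. J. Math. 116 (1994), (10.3)–(10.4)) with the
refined chart rings of `LogRegularRefinementChart.lean`:

* `exists_addMonoidHom_extend`, `addMonoidHom_ext_of_span_eq_top` — a multiplicative map on a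
  submonoid `S ⊆ ℤⁿ` with `ℤ S = ℤⁿ` into a commutative group extends uniquely to `ℤⁿ`
  (Kato (1.1): `Pᵍᵖ = {ab⁻¹}`);
* `ne_zero_of_span_range_eq_maximalIdeal` — if the maximal ideal of a Noetherian local ring of
  dimension `m` is generated by `y₁, …, y_m` then every `yⱼ ≠ 0` (Krull's height theorem);
* `monoidHom_apply_eq_prod_mul_unit` — for `Q = ℕ^I ⊕ ℤ^{Iᶜ}` in a `ℤ`-basis `b` of `ℤⁿ` and a
  monoid homomorphism `χ : Q → R` into a local ring, `χ(q) = ∏_{i ∉ U} χ(bᵢ)^{qᵢ} · (unit)` where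
  `U ⊇ Iᶜ` is the set of indices with `χ(bᵢ)` a unit.

References: [Kato1994] K. Kato, Toric singularities, Amer. J. Math. 116 (1994), (1.1), (10.3).
-/

noncomputable section

open IsLocalRing

namespace Literature.AlgebraicGeometry.Resolution

namespace LogRefinedChart

universe u

variable {n : ℕ}

/-! ### Extension of multiplicative maps from a spanning submonoid of `ℤⁿ` -/

section Extend

variable {G : Type*} [CommGroup G]

/-- **Kato (1.1), `Pᵍᵖ = {ab⁻¹ : a, b ∈ P}`: extension of a monoid homomorphism to the group
envelope.** A multiplicative map `ψ` on a submonoid `S ⊆ ℤⁿ` whose `ℤ`-span is `ℤⁿ`, with values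
in a commutative group, extends to an additive-to-multiplicative homomorphism on `ℤⁿ`.
[cite: Kato1994, (1.1)] -/
theorem exists_addMonoidHom_extend (S : AddSubmonoid (Fin n → ℤ))
    (hS : Submodule.span ℤ (S : Set (Fin n → ℤ)) = ⊤) (ψ : Multiplicative S →* G) :
    ∃ Θ : (Fin n → ℤ) →+ Additive G,
      ∀ (s : Fin n → ℤ) (hs : s ∈ S), Θ s = Additive.ofMul (ψ (Multiplicative.ofAdd ⟨s, hs⟩)) := by
  classical
  -- every vector is a difference of two elements of `S`
  have hmem : ∀ x : Fin n → ℤ, ∃ a ∈ S, ∃ b ∈ S, x = a - b := fun x =>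
    (LogChart.mem_span_int_iff_exists_sub S).1 (by rw [hS]; exact Submodule.mem_top)
  -- shorthand for `ψ` on elements of `S`
  let ψ' : ∀ a : Fin n → ℤ, a ∈ S → G := fun a ha => ψ (Multiplicative.ofAdd ⟨a, ha⟩)
  have hψ'add : ∀ (a : Fin n → ℤ) (ha : a ∈ S) (b : Fin n → ℤ) (hb : b ∈ S),
      ψ' (a + b) (S.add_mem ha hb) = ψ' a ha * ψ' b hb := by
    intro a ha b hb
    show ψ (Multiplicative.ofAdd ⟨a + b, _⟩) = _
    rw [← map_mul]
    rfl
  have hcongr : ∀ (a : Fin n → ℤ) (ha : a ∈ S) (a' : Fin n → ℤ) (ha' : a' ∈ S),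
      a = a' → ψ' a ha = ψ' a' ha' := by
    intro a ha a' ha' h
    subst h
    rfl
  -- well-definedness of `a − b ↦ ψ a / ψ b`
  have hwd : ∀ (a : Fin n → ℤ) (ha : a ∈ S) (b : Fin n → ℤ) (hb : b ∈ S)
      (a' : Fin n → ℤ) (ha' : a' ∈ S) (b' : Fin n → ℤ) (hb' : b' ∈ S),
      a - b = a' - b' → ψ' a ha / ψ' b hb = ψ' a' ha' / ψ' b' hb' := by
    intro a ha b hb a' ha' b' hb' h
    have h1 : a + b' = a' + b := by
      have := congrArg (· + b + b') h
      simp only [sub_add_cancel] at this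
      rw [this]; abel
    rw [div_eq_div_iff_mul_eq_mul, ← hψ'add, ← hψ'add]
    exact hcongr _ _ _ _ h1
  let Θ₀ : (Fin n → ℤ) → G := fun x =>
    ψ' (hmem x).choose (hmem x).choose_spec.1 /
      ψ' (hmem x).choose_spec.2.choose (hmem x).choose_spec.2.choose_spec.1
  have hΘ₀ : ∀ (a : Fin n → ℤ) (ha : a ∈ S) (b : Fin n → ℤ) (hb : b ∈ S),
      Θ₀ (a - b) = ψ' a ha / ψ' b hb := by
    intro a ha b hb
    exact hwd _ _ _ _ _ _ _ _ ((hmem (a - b)).choose_spec.2.choose_spec.2.symm)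
  refine ⟨{ toFun := fun x => Additive.ofMul (Θ₀ x), map_zero' := ?_, map_add' := ?_ }, ?_⟩
  · show Additive.ofMul (Θ₀ 0) = 0
    rw [show (0 : Fin n → ℤ) = 0 - 0 from (sub_zero 0).symm, hΘ₀ 0 S.zero_mem 0 S.zero_mem,
      div_self']
    rfl
  · intro x y
    show Additive.ofMul (Θ₀ (x + y)) = Additive.ofMul (Θ₀ x) + Additive.ofMul (Θ₀ y)
    obtain ⟨a, ha, b, hb, rfl⟩ := hmem x
    obtain ⟨a', ha', b', hb', rfl⟩ := hmem y
    rw [show a - b + (a' - b') = (a + a') - (b + b') by abel,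
      hΘ₀ _ (S.add_mem ha ha') _ (S.add_mem hb hb'), hΘ₀ a ha b hb, hΘ₀ a' ha' b' hb',
      hψ'add, hψ'add, ← ofMul_mul, mul_div_mul_comm]
  · intro s hs
    show Additive.ofMul (Θ₀ s) = _
    have h1 : Θ₀ s = Θ₀ (s - 0) := by rw [sub_zero]
    rw [h1, hΘ₀ s hs 0 S.zero_mem]
    congr 1
    rw [div_eq_iff_eq_mul, ← hψ'add]
    exact hcongr _ _ _ _ (add_zero s).symm

/-- Two additive maps `ℤⁿ → G` agreeing on a submonoid spanning `ℤⁿ` are equal.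
[cite: Kato1994, (1.1)] -/
theorem addMonoidHom_ext_of_span_eq_top {G' : Type*} [AddCommGroup G']
    (S : AddSubmonoid (Fin n → ℤ)) (hS : Submodule.span ℤ (S : Set (Fin n → ℤ)) = ⊤)
    {Θ Θ' : (Fin n → ℤ) →+ G'} (h : ∀ s ∈ S, Θ s = Θ' s) : Θ = Θ' := by
  refine AddMonoidHom.ext fun x => ?_
  obtain ⟨a, ha, b, hb, rfl⟩ := (LogChart.mem_span_int_iff_exists_sub S).1
    (show x ∈ Submodule.span ℤ (S : Set (Fin n → ℤ)) by rw [hS]; exact Submodule.mem_top)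
  rw [map_sub, map_sub, h a ha, h b hb]

end Extend

/-! ### Generators of the maximal ideal of a regular local ring are non-zero -/

/-- If the maximal ideal of a Noetherian local ring `R` is generated by `y₁, …, y_m` and
`dim R = m`, then each `yⱼ ≠ 0` (else `𝔪` would have `≤ m − 1` generators, contradicting
Krull's height theorem `dim R ≤ μ(𝔪)`). [cite: Kato1994, (10.3)] -/
theorem ne_zero_of_span_range_eq_maximalIdeal {R : Type u} [CommRing R] [IsLocalRing R]
    [IsNoetherianRing R] {m : ℕ} (y : Fin m → R)
    (hspan : Ideal.span (Set.range y) = maximalIdeal R) (hdim : ringKrullDim R = m)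
    (j : Fin m) : y j ≠ 0 := by
  classical
  intro hj
  -- `𝔪` is generated by the `m - 1` elements `y ∘ j.succAbove`... we use the image of
  -- `univ.erase j` instead
  have hspan' : maximalIdeal R = Ideal.span (y '' (↑(Finset.univ.erase j) : Set (Fin m))) := by
    rw [← hspan]
    refine le_antisymm (Ideal.span_le.2 ?_) (Ideal.span_mono (Set.image_subset_range _ _))
    rintro _ ⟨i, rfl⟩
    by_cases hij : i = j
    · rw [hij, hj]; exact Ideal.zero_mem _
    · exact Ideal.subset_span ⟨i, by simp [hij], rfl⟩
  have hfin : (y '' (↑(Finset.univ.erase j) : Set (Fin m))).Finite :=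
    (Finset.finite_toSet _).image _
  have h1 : (maximalIdeal R).spanFinrank ≤ m - 1 := by
    rw [hspan']
    refine (Submodule.spanFinrank_span_le_ncard_of_finite hfin).trans ?_
    refine (Set.ncard_image_le (Finset.finite_toSet _)).trans ?_
    rw [Set.ncard_coe_finset, Finset.card_erase_of_mem (Finset.mem_univ j), Finset.card_univ,
      Fintype.card_fin]
  have h2 := ringKrullDim_le_spanFinrank_maximalIdeal R
  rw [hdim] at h2
  have h3 : (m : WithBot ℕ∞) ≤ (m - 1 : ℕ) := h2.trans (by exact_mod_cast h1)
  have h4 : m ≤ m - 1 := by exact_mod_cast h3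
  have hm : 0 < m := Fin.pos j
  omega

/-! ### Monoids `ℕ^I ⊕ ℤ^{Iᶜ}` in a basis, and monoid homomorphisms into local rings -/

section Monomial

variable (b : Module.Basis (Fin n) ℤ (Fin n → ℤ)) (I : Finset (Fin n))
  (Q : AddSubmonoid (Fin n → ℤ))

/-- The monoid `Q = {x : bᵢ*(x) ≥ 0 for i ∈ I}` = `ℕ^I ⊕ ℤ^{Iᶜ}` in the coordinates of the basis
`b` (the dual monoid `σ^∨ ∩ M` of a regular cone, [Fulton1993Toric] §1.3). [cite: Kato1994, (9.8)] -/
structure IsOrthantLike : Prop where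
  /-- membership in `Q` is non-negativity of the `I`-coordinates -/
  mem_iff : ∀ x : Fin n → ℤ, x ∈ Q ↔ ∀ i ∈ I, 0 ≤ b.repr x i

variable {b I Q}

/-- Basis vectors lie in an orthant-like monoid. [cite: Kato1994, (9.8)] -/
theorem IsOrthantLike.basis_mem (hQ : IsOrthantLike b I Q) (i : Fin n) : b i ∈ Q := by
  rw [hQ.mem_iff]
  intro j _
  rw [Module.Basis.repr_self_apply]
  split_ifs <;> simp

/-- Off `I`, the negatives of the basis vectors lie in `Q` too. [cite: Kato1994, (9.8)] -/
theorem IsOrthantLike.neg_basis_mem (hQ : IsOrthantLike b I Q) {i : Fin n} (hi : i ∉ I) :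
    -b i ∈ Q := by
  rw [hQ.mem_iff]
  intro j hj
  rw [map_neg, Finsupp.neg_apply, Module.Basis.repr_self_apply]
  have : i ≠ j := fun h => hi (h ▸ hj)
  simp [this]

/-- The non-negative part `Σ (xᵢ)⁺ bᵢ` of a vector, in the basis `b`. [cite: Kato1994, (9.8)] -/
def posPart (b : Module.Basis (Fin n) ℤ (Fin n → ℤ)) (x : Fin n → ℤ) : Fin n → ℤ :=
  ∑ i, ((b.repr x i).toNat : ℤ) • b i

/-- The non-positive part `Σ (−xᵢ)⁺ bᵢ` of a vector, in the basis `b`. [cite: Kato1994, (9.8)] -/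
def negPart (b : Module.Basis (Fin n) ℤ (Fin n → ℤ)) (x : Fin n → ℤ) : Fin n → ℤ :=
  ∑ i, ((-b.repr x i).toNat : ℤ) • b i

/-- Coordinates of the positive part. [cite: Kato1994, (9.8)] -/
theorem repr_posPart (x : Fin n → ℤ) (i : Fin n) : b.repr (posPart b x) i = (b.repr x i).toNat := by
  simp only [posPart, map_sum, map_zsmul, Module.Basis.repr_self, Finsupp.coe_finsetSum,
    Finset.sum_apply, Finsupp.smul_apply, Finsupp.single_apply, smul_eq_mul, mul_ite, mul_one,
    mul_zero, Finset.sum_ite_eq', Finset.mem_univ, if_true]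

/-- Coordinates of the negative part. [cite: Kato1994, (9.8)] -/
theorem repr_negPart (x : Fin n → ℤ) (i : Fin n) :
    b.repr (negPart b x) i = (-b.repr x i).toNat := by
  simp only [negPart, map_sum, map_zsmul, Module.Basis.repr_self, Finsupp.coe_finsetSum,
    Finset.sum_apply, Finsupp.smul_apply, Finsupp.single_apply, smul_eq_mul, mul_ite, mul_one,
    mul_zero, Finset.sum_ite_eq', Finset.mem_univ, if_true]

/-- `x = x⁺ − x⁻`. [cite: Kato1994, (9.8)] -/
theorem posPart_sub_negPart (x : Fin n → ℤ) : posPart b x - negPart b x = x := by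
  apply b.repr.injective
  ext i
  rw [map_sub, Finsupp.sub_apply, repr_posPart, repr_negPart]
  omega

/-- The positive part of an element of `Q` lies in `Q`. [cite: Kato1994, (9.8)] -/
theorem IsOrthantLike.posPart_mem (hQ : IsOrthantLike b I Q) (x : Fin n → ℤ) : posPart b x ∈ Q := by
  rw [hQ.mem_iff]
  intro i _
  rw [repr_posPart]
  exact Int.natCast_nonneg _

/-- The negative part of any vector lies in `Q` provided its `I`-coordinates are `≥ 0`.
[cite: Kato1994, (9.8)] -/
theorem IsOrthantLike.negPart_mem (hQ : IsOrthantLike b I Q) (x : Fin n → ℤ) : negPart b x ∈ Q := by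
  rw [hQ.mem_iff]
  intro i _
  rw [repr_negPart]
  exact Int.natCast_nonneg _

/-- For `x ∈ Q` the negative part has zero `I`-coordinates. [cite: Kato1994, (9.8)] -/
theorem IsOrthantLike.repr_negPart_eq_zero (hQ : IsOrthantLike b I Q) {x : Fin n → ℤ} (hx : x ∈ Q)
    {i : Fin n} (hi : i ∈ I) : b.repr (negPart b x) i = 0 := by
  rw [repr_negPart]
  have := (hQ.mem_iff x).1 hx i hi
  simp only [Int.toNat_eq_zero.2 (neg_nonpos.2 this), Nat.cast_zero]

variable {R : Type u} [CommRing R]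

/-- A monoid homomorphism on `Q` evaluated at an `ℕ`-combination of the basis.
[cite: Kato1994, (9.8)] -/
theorem map_sum_natCast_smul (hQ : IsOrthantLike b I Q) (χ : Multiplicative Q →* R)
    (c : Fin n → ℕ) (hmem : (∑ i, ((c i : ℤ)) • b i) ∈ Q) :
    χ (Multiplicative.ofAdd ⟨∑ i, ((c i : ℤ)) • b i, hmem⟩) =
      ∏ i, χ (Multiplicative.ofAdd ⟨b i, hQ.basis_mem i⟩) ^ c i := by
  have key : ∀ s : Finset (Fin n), ∀ (h : (∑ i ∈ s, ((c i : ℤ)) • b i) ∈ Q),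
      χ (Multiplicative.ofAdd ⟨∑ i ∈ s, ((c i : ℤ)) • b i, h⟩) =
        ∏ i ∈ s, χ (Multiplicative.ofAdd ⟨b i, hQ.basis_mem i⟩) ^ c i := by
    intro s
    induction s using Finset.induction_on with
    | empty =>
      intro h
      simp only [Finset.sum_empty, Finset.prod_empty]
      rw [← map_one χ]; congr 1
    | @insert j s hj ih =>
      intro h
      have hs : (∑ i ∈ s, ((c i : ℤ)) • b i) ∈ Q := by
        rw [hQ.mem_iff]; intro i hi
        simp only [map_sum, map_zsmul, Module.Basis.repr_self, Finsupp.coe_finsetSum,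
          Finset.sum_apply, Finsupp.smul_apply, Finsupp.single_apply, smul_eq_mul, mul_ite,
          mul_one, mul_zero]
        exact Finset.sum_nonneg fun k _ => by split_ifs <;> simp
      have hj' : ((c j : ℤ)) • b j ∈ Q := by
        have : ((c j : ℤ)) • b j = (c j) • b j := by rw [natCast_zsmul]
        rw [this]; exact Q.nsmul_mem (hQ.basis_mem j) _
      rw [Finset.prod_insert hj, ← ih hs]
      have : (⟨∑ i ∈ insert j s, ((c i : ℤ)) • b i, h⟩ : Q) =
          ⟨((c j : ℤ)) • b j, hj'⟩ + ⟨∑ i ∈ s, ((c i : ℤ)) • b i, hs⟩ := by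
        apply Subtype.ext
        simp only [AddMemClass.mk_add_mk, Finset.sum_insert hj]
      rw [this, ofAdd_add, map_mul]
      congr 1
      have h2 : (⟨((c j : ℤ)) • b j, hj'⟩ : Q) = (c j) • ⟨b j, hQ.basis_mem j⟩ := by
        apply Subtype.ext
        simp only [AddSubmonoidClass.coe_nsmul, natCast_zsmul]
      rw [h2, ofAdd_nsmul, map_pow]
  have := key Finset.univ hmem
  simpa using this

/-- **Positive/negative part identity** for a monoid homomorphism `χ : Q → R`:
`χ(q) · ∏ χ(bᵢ)^{(−qᵢ)⁺} = ∏ χ(bᵢ)^{(qᵢ)⁺}`. [cite: Kato1994, (10.3)] -/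
theorem monoidHom_apply_mul_prod_neg_eq (hQ : IsOrthantLike b I Q) (χ : Multiplicative Q →* R)
    (q : Fin n → ℤ) (hq : q ∈ Q) :
    χ (Multiplicative.ofAdd ⟨q, hq⟩) *
        ∏ i, χ (Multiplicative.ofAdd ⟨b i, hQ.basis_mem i⟩) ^ (-b.repr q i).toNat =
      ∏ i, χ (Multiplicative.ofAdd ⟨b i, hQ.basis_mem i⟩) ^ (b.repr q i).toNat := by
  rw [← map_sum_natCast_smul hQ χ (fun i => (-b.repr q i).toNat) (hQ.negPart_mem q),
    ← map_sum_natCast_smul hQ χ (fun i => (b.repr q i).toNat) (hQ.posPart_mem q), ← map_mul,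
    ← ofAdd_add]
  congr 2
  apply Subtype.ext
  show q + negPart b q = posPart b q
  have := posPart_sub_negPart (b := b) q
  exact (sub_eq_iff_eq_add.1 this).symm

/-- The **unit part** of a monoid homomorphism `χ : Q → R` on a set `U` of indices at which
`χ(bᵢ)` is a unit: the additive-to-multiplicative map `x ↦ ∏_{i ∈ U} χ(bᵢ)^{xᵢ}` on all of `ℤⁿ`
(integer exponents of units). [cite: Kato1994, (10.3)] -/
def unitPart (hQ : IsOrthantLike b I Q) (χ : Multiplicative Q →* R) (U : Finset (Fin n))
    (hU : ∀ i ∈ U, IsUnit (χ (Multiplicative.ofAdd ⟨b i, hQ.basis_mem i⟩))) :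
    (Fin n → ℤ) →+ Additive Rˣ where
  toFun x := ∑ i ∈ U.attach, (b.repr x i) • Additive.ofMul (hU i i.2).unit
  map_zero' := by simp
  map_add' x y := by
    rw [← Finset.sum_add_distrib]
    refine Finset.sum_congr rfl fun i _ => ?_
    rw [map_add, Finsupp.add_apply, add_zsmul]

/-- The unit part on a vector, as an element of `R`. [cite: Kato1994, (10.3)] -/
theorem coe_unitPart (hQ : IsOrthantLike b I Q) (χ : Multiplicative Q →* R) (U : Finset (Fin n))
    (hU : ∀ i ∈ U, IsUnit (χ (Multiplicative.ofAdd ⟨b i, hQ.basis_mem i⟩))) (x : Fin n → ℤ) :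
    ((Additive.toMul (unitPart hQ χ U hU x) : Rˣ) : R) =
      ∏ i ∈ U.attach, (((hU i i.2).unit ^ (b.repr x i) : Rˣ) : R) := by
  show ((Additive.toMul (∑ i ∈ U.attach, (b.repr x i) • Additive.ofMul (hU i i.2).unit) : Rˣ) : R)
    = _
  rw [toMul_sum, Units.coe_prod]
  rfl

/-- On a basis vector `bᵢ` with `i ∈ U` the unit part is `χ(bᵢ)`. [cite: Kato1994, (10.3)] -/
theorem coe_unitPart_basis (hQ : IsOrthantLike b I Q) (χ : Multiplicative Q →* R)
    (U : Finset (Fin n))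
    (hU : ∀ i ∈ U, IsUnit (χ (Multiplicative.ofAdd ⟨b i, hQ.basis_mem i⟩))) {i : Fin n}
    (hi : i ∈ U) :
    ((Additive.toMul (unitPart hQ χ U hU (b i)) : Rˣ) : R) =
      χ (Multiplicative.ofAdd ⟨b i, hQ.basis_mem i⟩) := by
  rw [coe_unitPart]
  rw [Finset.prod_eq_single ⟨i, hi⟩]
  · rw [Module.Basis.repr_self_apply, if_pos rfl, zpow_one, IsUnit.unit_spec]
  · rintro ⟨j, hj⟩ _ hne
    rw [Module.Basis.repr_self_apply, if_neg (fun h => hne (Subtype.ext h.symm)), zpow_zero,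
      Units.val_one]
  · intro h; exact absurd (Finset.mem_attach _ _) h

/-- If all `U`-coordinates of `x` vanish, the unit part is `1`. [cite: Kato1994, (10.3)] -/
theorem unitPart_eq_zero_of_repr_eq_zero (hQ : IsOrthantLike b I Q) (χ : Multiplicative Q →* R)
    (U : Finset (Fin n))
    (hU : ∀ i ∈ U, IsUnit (χ (Multiplicative.ofAdd ⟨b i, hQ.basis_mem i⟩))) {x : Fin n → ℤ}
    (hx : ∀ i ∈ U, b.repr x i = 0) : unitPart hQ χ U hU x = 0 := by
  show ∑ i ∈ U.attach, (b.repr x i) • Additive.ofMul (hU i i.2).unit = 0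
  exact Finset.sum_eq_zero fun i _ => by rw [hx i i.2, zero_smul]

/-- **Monomial–unit factorisation.** Let `Q = ℕ^I ⊕ ℤ^{Iᶜ}` in the basis `b`, `χ : Q → R` a
monoid homomorphism, and `U ⊇ Iᶜ` a set of indices such that `χ(bᵢ)` is a unit for `i ∈ U`.
Then for `q ∈ Q`: `χ(q) = ∏_{i ∉ U} χ(bᵢ)^{qᵢ} · ∏_{i ∈ U} χ(bᵢ)^{qᵢ}`, the second factor
being the unit part (integer exponents). [cite: Kato1994, (10.3)] -/
theorem monoidHom_apply_eq_prod_mul_unitPart (hQ : IsOrthantLike b I Q)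
    (χ : Multiplicative Q →* R) (U : Finset (Fin n))
    (hU : ∀ i ∈ U, IsUnit (χ (Multiplicative.ofAdd ⟨b i, hQ.basis_mem i⟩)))
    (hIU : ∀ i, i ∉ I → i ∈ U) (q : Fin n → ℤ) (hq : q ∈ Q) :
    χ (Multiplicative.ofAdd ⟨q, hq⟩) =
      (∏ i ∈ Uᶜ, χ (Multiplicative.ofAdd ⟨b i, hQ.basis_mem i⟩) ^ (b.repr q i).toNat) *
        ((Additive.toMul (unitPart hQ χ U hU q) : Rˣ) : R) := by
  classical
  have key := monoidHom_apply_mul_prod_neg_eq hQ χ q hq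
  -- the `Uᶜ`-coordinates of `q` are non-negative, so the negative parts there vanish
  have hneg : ∀ i ∈ Uᶜ, (-b.repr q i).toNat = 0 := by
    intro i hi
    rw [Finset.mem_compl] at hi
    have hiI : i ∈ I := by by_contra h; exact hi (hIU i h)
    exact Int.toNat_eq_zero.2 (neg_nonpos.2 ((hQ.mem_iff q).1 hq i hiI))
  rw [← Finset.prod_mul_prod_compl U, ← Finset.prod_mul_prod_compl U] at key
  have h1 : ∏ i ∈ Uᶜ, χ (Multiplicative.ofAdd ⟨b i, hQ.basis_mem i⟩) ^ (-b.repr q i).toNat = 1 :=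
    Finset.prod_eq_one fun i hi => by rw [hneg i hi, pow_zero]
  rw [h1, mul_one] at key
  -- the `U`-factors are units: divide
  set uU : Rˣ := ∏ i ∈ U.attach, (hU i i.2).unit ^ (-b.repr q i).toNat with huU
  set vU : Rˣ := ∏ i ∈ U.attach, (hU i i.2).unit ^ (b.repr q i).toNat with hvU
  have huU' : (uU : R) =
      ∏ i ∈ U, χ (Multiplicative.ofAdd ⟨b i, hQ.basis_mem i⟩) ^ (-b.repr q i).toNat := by
    rw [huU, Units.coe_prod, ← Finset.prod_attach U]
    refine Finset.prod_congr rfl fun i _ => ?_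
    rw [Units.val_pow_eq_pow_val, IsUnit.unit_spec]
  have hvU' : (vU : R) =
      ∏ i ∈ U, χ (Multiplicative.ofAdd ⟨b i, hQ.basis_mem i⟩) ^ (b.repr q i).toNat := by
    rw [hvU, Units.coe_prod, ← Finset.prod_attach U]
    refine Finset.prod_congr rfl fun i _ => ?_
    rw [Units.val_pow_eq_pow_val, IsUnit.unit_spec]
  rw [← huU', ← hvU'] at key
  -- `unitPart q = vU * uU⁻¹`
  have hw0 : (Additive.toMul (unitPart hQ χ U hU q) : Rˣ) = vU * uU⁻¹ := by
    have h2 : (Additive.toMul (unitPart hQ χ U hU q) : Rˣ) =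
        ∏ i ∈ U.attach, (hU i i.2).unit ^ (b.repr q i) := by
      show Additive.toMul (∑ i ∈ U.attach, (b.repr q i) • Additive.ofMul (hU i i.2).unit) = _
      rw [toMul_sum]
      rfl
    rw [h2, hvU, huU, ← Finset.prod_inv_distrib, ← Finset.prod_mul_distrib]
    refine Finset.prod_congr rfl fun i _ => ?_
    rw [← zpow_natCast, ← zpow_natCast, ← zpow_neg, ← zpow_add]
    congr 1
    omega
  have hw : ((Additive.toMul (unitPart hQ χ U hU q) : Rˣ) : R) = (vU : R) * ↑uU⁻¹ := by
    rw [hw0, Units.val_mul]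
  have key' : χ (Multiplicative.ofAdd ⟨q, hq⟩) =
      (vU : R) * (∏ i ∈ Uᶜ, χ (Multiplicative.ofAdd ⟨b i, hQ.basis_mem i⟩) ^ (b.repr q i).toNat)
        * ↑uU⁻¹ := by
    rw [← key, mul_assoc, Units.mul_inv, mul_one]
  rw [key', hw]
  ring

end Monomial

end LogRefinedChart

end Literature.AlgebraicGeometry.Resolution
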